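import Literature.AlgebraicGeometry.Modules.CechThetaVanishing
import Literature.AlgebraicGeometry.Modules.SheafHomFunctor
import Literature.AlgebraicGeometry.Modules.LocalFrames
import HarnessLib

/-!
# The exchange–evaluation chain map `𝓗om(E, Č•(𝓤, M)) → Č•(𝓤, N)` of a morphism `t : 𝓗om(E, M) → N`

Let `E, M, N` be `𝒪_X`-modules on a scheme `X`, `𝓤 = (U_a)_{a ∈ ι}` a family of opens and
`t : 𝓗om(E, M) ⟶ N` a morphism (e.g. the trace `𝓔nd(E) → 𝒪_X` or the contraction
`𝓗om(E, 𝓗om(E^∨, G)) → G` of a finite locally free `E`). A section of `𝓗om(E, Čⁿ(𝓤, M))` over `W`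
is a morphism `ψ : E|_W → Čⁿ(𝓤, M)|_W`; its `α`-component is a morphism
`ψ_α : E|_{W ∩ U_α} → M|_{W ∩ U_α}` (`Cech.componentOver`), and

  `κ_t(ψ) = (t(ψ_α))_α ∈ Γ(W, Čⁿ(𝓤, N))`

defines morphisms `Cech.exchange t n : 𝓗om(E, Čⁿ(𝓤, M)) ⟶ Čⁿ(𝓤, N)` which

* commute with the Čech differentials (`Cech.exchange_comp_d`), so form a chain map
  `Cech.exchangeChainMap t : 𝓗om(E, Č•(𝓤, M)) ⟶ Č•(𝓤, N)` (source = the image of the Čech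
  resolution under the functor `𝓗om(E, –)`, Mathlib `Functor.mapHomologicalComplex`);
* are compatible with the augmentations: `𝓗om(E, ε_M) ≫ κ⁰_t = t ≫ ε_N` (`Cech.exchange_augment`);
* satisfy **`unit ≫ 𝓗om(E, ω♯) ≫ κⁿ_t = (t_* ω)♯`** for a cochain of local homomorphisms
  `ω = (ω_α : E|_{U_α} → M|_{U_α})` (`Cech.sheafHomUnit_familyHom_exchange`), where
  `t_* ω = Cech.pushFamily t ω` is the cochain `α ↦ (r ↦ r • t(ω_α))` of local homomorphisms
  `𝒪|_{U_α} → N|_{U_α}`.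

These are the three inputs that turn `θ` (`IteratedExtClass`) of a Čech class with values in
`𝓗om(E, M)`-coefficients into the Čech class of its image under `t`
(`Modules/CechThetaTrace.lean`: `Tr(θ(ω)) = θ(tr ω)`). Everything is proved; no named facts.

## References

* R. Hartshorne, *Algebraic Geometry*, GTM 52 (1977), III.4 and III.6.7. [Hartshorne1977]
* R.-O. Buchweitz, H. Flenner, *A semiregularity map for modules and applications to deformations*,
  Compositio Math. 137 (2003), §4 (trace map). [BuchweitzFlenner2003]
-/

noncomputable section

universe u

open CategoryTheory CategoryTheory.Abelian AlgebraicGeometry Opposite TopologicalSpace Limits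

namespace Literature.AlgebraicGeometry.Modules

open Literature.AlgebraicGeometry.Motives

namespace Cech

variable {X : Scheme.{u}} {ι : Type u} {U : ι → X.Opens} {n : ℕ} {E M N : X.Modules}

/-- Iterated restrictions of sections of `𝒪_X` only depend on the total restriction. [folklore] -/
lemma structure_map_map {V W Y : X.Opens} (f : op V ⟶ op W) (g : op W ⟶ op Y) (h : op V ⟶ op Y)
    (a : Γ(X, V)) : X.presheaf.map g (X.presheaf.map f a) = X.presheaf.map h a := by
  have hfg : f ≫ g = h := Quiver.Hom.unop_inj (Subsingleton.elim _ _)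
  rw [← hfg, Functor.map_comp]
  rfl

/-! ### Components of a morphism `E|_W → Čⁿ(𝓤, M)|_W` -/

/-- **The `α`-component `ψ_α : E|_{W ∩ U_α} → M|_{W ∩ U_α}` of a morphism
`ψ : E|_W → Čⁿ(𝓤, M)|_W`**: `s ↦ ψ(s)_α|` (`ψ(s)_α ∈ Γ(M, W' ∩ U_α)` for `s ∈ Γ(E, W')`,
`W' ≤ W ∩ U_α`). [folklore] -/
def componentOver {W : X.Opens} (ψ : E.over W ⟶ (obj U n M).over W) (α : Fin (n + 1) → ι) :
    E.over (W ⊓ face U α) ⟶ M.over (W ⊓ face U α) :=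
  overHomMk
    (fun W' k =>
      { toFun := fun s => res M (le_inf le_rfl (k.le.trans inf_le_right))
          ((appLE ψ (k ≫ homOfLE inf_le_left) s : Sections U n M W') α)
        map_zero' := by rw [appLE_zero_right, obj_zero_apply, map_zero]
        map_add' := fun s s' => by rw [appLE_add_right, obj_add_apply, map_add] })
    (fun W' k r s => by
      change res M _ ((appLE ψ _ (r • s) : Sections U n M W') α) =
        r • res M _ ((appLE ψ _ s : Sections U n M W') α)
      rw [appLE_smul_right, obj_smul_apply, res_smul, resO_resO, resO_self])
    (fun W' V k k' l s => by
      change res M _ ((appLE ψ (k' ≫ homOfLE inf_le_left) (E.presheaf.map l.op s) : Sections U n M V) α) =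
        M.presheaf.map l.op (res M _ ((appLE ψ (k ≫ homOfLE inf_le_left) s : Sections U n M W') α))
      rw [appLE_congr_hom ψ (k' ≫ homOfLE inf_le_left) (l ≫ (k ≫ homOfLE inf_le_left)), appLE_map,
        obj_map_apply, res_res, presheaf_map_eq_res l, res_res])

/-- Values of the component. [folklore] -/
@[simp] lemma appLE_componentOver {W W' : X.Opens} (ψ : E.over W ⟶ (obj U n M).over W)
    (α : Fin (n + 1) → ι) (k : W' ⟶ W ⊓ face U α) (s : Γ(E, W')) :
    appLE (componentOver ψ α) k s = res M (le_inf le_rfl (k.le.trans inf_le_right))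
      ((appLE ψ (k ≫ homOfLE inf_le_left) s : Sections U n M W') α) :=
  rfl

/-- Components are additive. [folklore] -/
lemma componentOver_add {W : X.Opens} (ψ ψ' : E.over W ⟶ (obj U n M).over W) (α : Fin (n + 1) → ι) :
    componentOver (ψ + ψ') α = componentOver ψ α + componentOver ψ' α :=
  hom_ext_of_appLE fun W' k s => by
    rw [appLE_add, appLE_componentOver, appLE_componentOver, appLE_componentOver, appLE_add,
      obj_add_apply, map_add]

/-- Components are `𝒪(W)`-semilinear: `(a • ψ)_α = a| • ψ_α`. [folklore] -/
lemma componentOver_smul {W : X.Opens} (a : Γ(X, W)) (ψ : E.over W ⟶ (obj U n M).over W)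
    (α : Fin (n + 1) → ι) :
    componentOver (a • ψ) α = X.presheaf.map (homOfLE (inf_le_left : W ⊓ face U α ≤ W)).op a •
      componentOver ψ α :=
  hom_ext_of_appLE fun W' k s => by
    rw [appLE_smul, appLE_componentOver, appLE_componentOver, appLE_smul, obj_smul_apply, res_smul,
      resO_resO]
    congr 1
    change (X.presheaf.map _) ((X.presheaf.map _) a) = (X.presheaf.map _) ((X.presheaf.map _) a)
    rw [structure_map_map _ _ (k ≫ homOfLE inf_le_left).op a,
      structure_map_map _ _ (k ≫ homOfLE inf_le_left).op a]

/-- Components commute with restriction of `W`. [folklore] -/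
lemma componentOver_restrictHom {W W₁ : X.Opens} (i : W₁ ⟶ W) (ψ : E.over W ⟶ (obj U n M).over W)
    (α : Fin (n + 1) → ι) :
    componentOver (restrictHom i ψ) α =
      restrictHom (homOfLE (inf_le_inf_right (face U α) i.le)) (componentOver ψ α) :=
  hom_ext_of_appLE fun W' k s => by
    rw [appLE_componentOver, appLE_restrictHom, appLE_restrictHom, appLE_componentOver,
      appLE_congr_hom ψ ((k ≫ homOfLE inf_le_left) ≫ i)
        ((k ≫ homOfLE (inf_le_inf_right (face U α) i.le)) ≫ homOfLE inf_le_left)]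

/-- **Components of `ψ ≫ d`**: `(ψ ≫ d)_α = Σ_k (-1)^k (ψ_{α∘δ_k})|_{W ∩ U_α}`. [folklore] -/
lemma componentOver_comp_d {W : X.Opens} (ψ : E.over W ⟶ (obj U n M).over W) (α : Fin (n + 2) → ι) :
    componentOver (ψ ≫ (SheafOfModules.overFunctor _ W).map (d U M n)) α =
      ∑ k : Fin (n + 2), (-1 : ℤ) ^ (k : ℕ) •
        restrictHom (homOfLE (inf_le_inf_left W (face_le_face_comp U α (Fin.succAbove k))))
          (componentOver ψ (α ∘ Fin.succAbove k)) :=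
  hom_ext_of_appLE fun W' k s => by
    rw [appLE_componentOver, appLE_comp_over_map, d_app_apply, map_sum, appLE_sum]
    refine Finset.sum_congr rfl fun l _ => ?_
    rw [map_zsmul, appLE_zsmul, appLE_restrictHom, appLE_componentOver, res_res,
      appLE_congr_hom ψ (k ≫ homOfLE inf_le_left)
        ((k ≫ homOfLE (inf_le_inf_left W (face_le_face_comp U α (Fin.succAbove l)))) ≫ homOfLE inf_le_left)]

/-- **Components of `ψ₀ ≫ ε`** (the augmentation): `(ψ₀ ≫ ε)_α = ψ₀|_{W ∩ U_α}`. [folklore] -/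
lemma componentOver_comp_augment {W : X.Opens} (ψ₀ : E.over W ⟶ M.over W) (α : Fin 1 → ι) :
    componentOver (ψ₀ ≫ (SheafOfModules.overFunctor _ W).map (augment U M)) α =
      restrictHom (homOfLE (inf_le_left : W ⊓ face U α ≤ W)) ψ₀ :=
  hom_ext_of_appLE fun W' k s => by
    rw [appLE_componentOver, appLE_comp_over_map, augment_app_apply, res_res, appLE_restrictHom,
      ← presheaf_map_eq_res (𝟙 W'), ← appLE_map,
      appLE_congr_hom ψ₀ (𝟙 W' ≫ k ≫ homOfLE inf_le_left) (k ≫ homOfLE inf_le_left)]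
    congr 1
    exact (presheaf_map_eq_res (𝟙 W') s).trans (res_self _ s)

/-- **Components of `f|_W` for a cochain `f = ω♯`**: `(ω♯|_W)_α = ω_α|_{W ∩ U_α}`. [folklore] -/
lemma componentOver_over_map_familyHom (ω : LocalFamily U n E M) (W : X.Opens) (α : Fin (n + 1) → ι) :
    componentOver ((SheafOfModules.overFunctor _ W).map (familyHom ω)) α =
      restrictHom (homOfLE (inf_le_right : W ⊓ face U α ≤ face U α)) (ω α) :=
  hom_ext_of_appLE fun W' k s => by
    rw [appLE_componentOver, appLE_over_map, familyHom_app_apply, appLE_restrictHom,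
      appLE_congr_hom (ω α) (homOfLE inf_le_right)
        (homOfLE (inf_le_left : W' ⊓ face U α ≤ W') ≫ k ≫ homOfLE inf_le_right)]
    change res M _ (appLE (ω α) (homOfLE _ ≫ k ≫ homOfLE inf_le_right)
      (E.presheaf.map (homOfLE _).op s)) = _
    rw [appLE_map, presheaf_map_eq_res (homOfLE (inf_le_left : W' ⊓ face U α ≤ W')), res_res, res_self]

/-! ### The exchange–evaluation morphisms `κⁿ_t : 𝓗om(E, Čⁿ(𝓤, M)) → Čⁿ(𝓤, N)` -/

variable (t : sheafHom E M ⟶ N)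

/-- Naturality of `t` with respect to restriction of local homomorphisms. [folklore] -/
lemma app_restrictHom {W W' : X.Opens} (h : W' ≤ W) (φ : E.over W ⟶ M.over W) :
    t.app W' (restrictHom (homOfLE h) φ) = res N h (t.app W φ) :=
  app_res t h φ

variable (n)

/-- **The exchange–evaluation morphism** `κⁿ_t : 𝓗om(E, Čⁿ(𝓤, M)) → Čⁿ(𝓤, N)`,
`ψ ↦ (t(ψ_α))_α`. [folklore] -/
def exchange : sheafHom E (obj U n M) ⟶ obj U n N :=
  homMk (fun W (ψ : E.over W ⟶ (obj U n M).over W) α => t.app (W ⊓ face U α) (componentOver ψ α))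
    (fun W (ψ ψ' : E.over W ⟶ (obj U n M).over W) => funext fun α =>
      (congrArg (t.app (W ⊓ face U α)) (componentOver_add ψ ψ' α)).trans (map_add _ _ _))
    (fun W r (ψ : E.over W ⟶ (obj U n M).over W) => funext fun α =>
      (congrArg (t.app (W ⊓ face U α)) (componentOver_smul r ψ α)).trans
        (Scheme.Modules.Hom.app_smul t _ _))
    (fun W W' i (ψ : E.over W ⟶ (obj U n M).over W) => funext fun α => by
      rw [restrict_apply]
      change t.app _ (componentOver (restrictHom i ψ) α) = _
      rw [componentOver_restrictHom]
      exact app_restrictHom t _ _)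

/-- Components of `κⁿ_t`. [folklore] -/
@[simp] lemma exchange_app_apply (W : X.Opens) (ψ : E.over W ⟶ (obj U n M).over W)
    (α : Fin (n + 1) → ι) :
    ((exchange n t).app W ψ : Sections U n N W) α = t.app (W ⊓ face U α) (componentOver ψ α) := rfl

/-- **`κ_t` commutes with the Čech differentials.** [folklore] -/
theorem exchange_comp_d :
    exchange n t ≫ d U N n = sheafHomMap E (d U M n) ≫ exchange (n + 1) t := by
  refine hom_ext_to fun W (ψ : E.over W ⟶ (obj U n M).over W) α => ?_
  rw [Scheme.Modules.Hom.comp_app, CategoryTheory.comp_apply, d_app_apply, Scheme.Modules.Hom.comp_app,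
    CategoryTheory.comp_apply, sheafHomMap_app_apply, exchange_app_apply, componentOver_comp_d]
  refine Eq.trans (Finset.sum_congr rfl fun k _ => ?_) (map_sum (t.app (W ⊓ face U α)).hom _ _).symm
  rw [exchange_app_apply]
  exact ((map_zsmul (t.app (W ⊓ face U α)).hom _ _).trans
    (congrArg ((-1 : ℤ) ^ (k : ℕ) • ·) (app_restrictHom t _ _))).symm

/-- **`κ_t` is compatible with the augmentations**: `𝓗om(E, ε_M) ≫ κ⁰_t = t ≫ ε_N`. [folklore] -/
theorem exchange_augment :
    sheafHomMap E (augment U M) ≫ exchange 0 t = t ≫ augment U N := by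
  refine hom_ext_to fun W (ψ₀ : E.over W ⟶ M.over W) α => ?_
  rw [Scheme.Modules.Hom.comp_app, CategoryTheory.comp_apply, Scheme.Modules.Hom.comp_app,
    CategoryTheory.comp_apply, sheafHomMap_app_apply, exchange_app_apply,
    componentOver_comp_augment, app_restrictHom, augment_app_apply]

variable (U M)

/-- **The exchange–evaluation chain map** `κ_t : 𝓗om(E, Č•(𝓤, M)) ⟶ Č•(𝓤, N)`. [folklore] -/
def exchangeChainMap :
    ((sheafHomFunctor E).mapHomologicalComplex _).obj (complex U M) ⟶ complex U N where
  f n := exchange n t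
  comm' n m h := by
    cases h
    change exchange n t ≫ (complex U N).d n (n + 1) =
      sheafHomMap E ((complex U M).d n (n + 1)) ≫ exchange (n + 1) t
    rw [complex_d, complex_d]
    exact exchange_comp_d n t

/-- The components of the chain map. [folklore] -/
@[simp] lemma exchangeChainMap_f : (exchangeChainMap U M t).f n = exchange n t := rfl

variable {U M n}

/-! ### The pushed-forward cochain `t_* ω` and `unit ≫ 𝓗om(E, ω♯) ≫ κ_t = (t_* ω)♯` -/

/-- **The pushed-forward cochain** `t_* ω`: `α ↦ (r ↦ r • t(ω_α))`, a cochain of local homomorphisms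
`𝒪|_{U_α} → N|_{U_α}`. [folklore] -/
def pushFamily (ω : LocalFamily U n E M) : LocalFamily U n (unitModule X) N :=
  fun α => smulSection (t.app (face U α) (ω α))

/-- Unfolding. [folklore] -/
lemma pushFamily_apply (ω : LocalFamily U n E M) (α : Fin (n + 1) → ι) :
    pushFamily t ω α = smulSection (t.app (face U α) (ω α)) := rfl

/-- Components of `overScalar r ≫ (ω♯)|_W`: `r| • ω_α|`. [folklore] -/
lemma componentOver_overScalar_comp_familyHom (ω : LocalFamily U n E M) (W : X.Opens) (r : Γ(X, W))
    (α : Fin (n + 1) → ι) :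
    componentOver (overScalar E W r ≫ (SheafOfModules.overFunctor _ W).map (familyHom ω)) α =
      X.presheaf.map (homOfLE (inf_le_left : W ⊓ face U α ≤ W)).op r •
        restrictHom (homOfLE (inf_le_right : W ⊓ face U α ≤ face U α)) (ω α) := by
  rw [← over_map_overScalar, ← smul_overHom_def, componentOver_smul, componentOver_over_map_familyHom]

/-- **`unit ≫ 𝓗om(E, ω♯) ≫ κⁿ_t = (t_* ω)♯`.** [folklore] -/
theorem sheafHomUnit_familyHom_exchange (ω : LocalFamily U n E M) :
    sheafHomUnit E ≫ sheafHomMap E (familyHom ω) ≫ exchange n t = familyHom (pushFamily t ω) := by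
  refine hom_ext_to fun W (r : Γ(X, W)) α => ?_
  rw [Scheme.Modules.Hom.comp_app, CategoryTheory.comp_apply, Scheme.Modules.Hom.comp_app,
    CategoryTheory.comp_apply, sheafHomUnit_app_apply, sheafHomMap_app_apply, exchange_app_apply,
    familyHom_app_apply, pushFamily_apply, appLE_smulSection]
  calc t.app (W ⊓ face U α) (componentOver (overScalar E W r ≫
          (SheafOfModules.overFunctor _ W).map (familyHom ω)) α)
      = t.app (W ⊓ face U α) (X.presheaf.map (homOfLE (inf_le_left : W ⊓ face U α ≤ W)).op r •
          restrictHom (homOfLE (inf_le_right : W ⊓ face U α ≤ face U α)) (ω α)) :=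
        congrArg _ (componentOver_overScalar_comp_familyHom ω W r α)
    _ = X.presheaf.map (homOfLE (inf_le_left : W ⊓ face U α ≤ W)).op r •
          t.app (W ⊓ face U α) (restrictHom (homOfLE (inf_le_right : W ⊓ face U α ≤ face U α)) (ω α)) :=
        Scheme.Modules.Hom.app_smul t _ _
    _ = X.presheaf.map (homOfLE (inf_le_left : W ⊓ face U α ≤ W)).op r •
          res N (inf_le_right : W ⊓ face U α ≤ face U α) (t.app (face U α) (ω α)) := by
        rw [app_restrictHom]
    _ = _ := rfl

end Cech

end Literature.AlgebraicGeometry.Modules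

end
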